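import Summits.KontsevichZagierPeriods.KontsevichZagierPeriods.Theorems.RootDecompWalshStrataCutBall4Descent
import Summits.KontsevichZagierPeriods.KontsevichZagierPeriods.Theorems.RootDecompWalshStrataCutBall4PairChart
import Summits.KontsevichZagierPeriods.KontsevichZagierPeriods.Theorems.RootDecompWalshStrataCutBall4WideChart
import Summits.KontsevichZagierPeriods.KontsevichZagierPeriods.Theorems.RootDecompWalshStrataCutBall4ThreePieces

/-!
# Root decomposition on Walsh strata — part 113 (gen 13, addendum 1): face-cut balls with `ρ ≤ 3` descend to `[hq]·B`

Crux `QuadricSignKernel` (item 25393), slice `d = 4`.  THE SPECIMEN of part 107 extended from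
`ρ ≤ 2` to `ρ ≤ 3`: for every rational `ρ ≤ 3` and weight `q` the face-cut ball cell
`[(0,1)⁴ ∩ {Σxᵢ² < ρ}, q]` is `InPiBaker` (`inPiBaker_cutBall_three`).  In the regime `2 < ρ ≤ 3`
two coordinates can exceed `1` simultaneously, the caps `K_i(ρ)` overlap pairwise, and the value
acquires the new proper terms `π·arctan`-products of the overlaps `K_{im}` — still affine in `π`
over the Baker field, as the descent shows INSIDE THE RULES:

1. every wide cap `[K_i(ρ), q]`, `ρ ≤ 4`, is `InPiBaker`: the rescaled `2+2` chart of part 111 from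
   `tRepH × disc`, where `tRepH = [T♯(ρ), 8q·g♯]` is the rule-(3) length representation of the
   constant-weight band under `g♯` over `T♯(ρ)` — the standard cell of the `3`-dimensional quadric
   `p3W ρ = ρ − (1+X₀)² − 4X₁² − 4X₂` up to a null face — `InBaker` by the PROVED support
   `QuadricBakerDescent` (`quadricBakerDescent_holds`), and the disc is `[hq,1]`;
2. every overlap `[K_{im}(ρ), q]`, `ρ ≤ 3`, is `InPiBaker`: the chart of part 109 from `t2Rep × disc`,
   `t2Rep` the length representation of the cell of `p3P ρ = ρ − (1+X₀)² − (1+X₁)² − X₂` (up to two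
   null faces);
3. the signed peel of part 112: `[B_0] ≡ [unit cell, ρ²q]` (dilation), `[L_{i,0}] = [K_i]`,
   `[L_{i,m+1}] = [L_{i,m}] − [K_{im}]` (`m < i`), `[B_{i+1}] = [B_i] − [L_{i,i}]`, `[C_ρ] = [B_4]`.

Consequences: `sum_mem_relations_cutBalls_three` — every vanishing `ℤ`-combination of cells
`[C_{ρᵢ}, qᵢ]`, `ρᵢ ≤ 3`, is a Kontsevich–Zagier relation, UNCONDITIONALLY; the cut balls `ρ ≤ 3`
join the affine-`π` inventory of part 107.  (For `3 < ρ < 4` the triple overlaps `K_{ijk}` carry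
genuinely weight-two terms and the cell is expected OUTSIDE the class `A`; not treated.)
[KontsevichZagier2001 §1.2, §4.1; Baker1975 Thm 2.1; BCR1998 §2.1]
-/

noncomputable section

open Literature.NumberTheory.Transcendental
open MeasureTheory Set
open MvPolynomial (aeval X C rename bind₁)
open Literature.ModelTheory.ExponentialFields (IsSemialgebraic isSemialgebraic_setOf_eval_eq_zero)
open Summit.KontsevichZagierPeriods.RootDecompWalshStrata.WalshSpanProof (cellRep cellRep_domain
  cellRep_integrand)
open Summit.KontsevichZagierPeriods.RootDecompWalshStrata.ConeSpecimen (discPoly)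
open Summit.KontsevichZagierPeriods.RootDecompWalshStrata.ConicDescent (InBaker bandRep bandRep_domain
  bandRep_integrand oband mem_oband of_bandRep_sub_of_lenRep_mem_relations)
open Summit.KontsevichZagierPeriods.RootDecompWalshStrata.Ball4 (ball4Poly)
open Summit.KontsevichZagierPeriods.RootDecompWalshStrata.PiSector (hqRep)
open Summit.KontsevichZagierPeriods.RootDecompWalshStrata.PiAt (QuadricDescentAt descentAt_rename_reflect)
open Summit.KontsevichZagierPeriods.RootDecompWalshStrata.PiB (InPiBaker piBGens affGens
  piBDescentAt_of_inPiBaker sum_mem_relations_piB affDescentAt_of_piBDescentAt)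

namespace Summit.KontsevichZagierPeriods.RootDecompWalshStrata.CutBall4

variable {ρ : ℚ}

/-! #### 0. Two lemmas on `3`-variable polynomials -/

/-- The coordinate hyperplane `{z₀ = 0}` or `{z₁ = 0}` of `ℝ³` is `ℚ`-semialgebraic. [BCR1998 §2.1] -/
theorem isSemialgebraic_hyperplane3 (j : Fin 3) : IsSemialgebraic ℚ {z : Fin 3 → ℝ | z j = 0} := by
  convert isSemialgebraic_setOf_eval_eq_zero (k := ℚ) (R := ℝ) (X j : MvPolynomial (Fin 3) ℚ) using 1
  ext z
  simp

/-- A coordinate hyperplane of `ℝ³` is Lebesgue-null. [folklore] -/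
theorem volume_hyperplane3 (j : Fin 3) : volume {z : Fin 3 → ℝ | z j = 0} = 0 := by
  rw [volume_pi]
  exact Measure.pi_hyperplane _ _ _

/-! #### 1. The wide cap `[K_i(ρ), q]`, `ρ ≤ 4`, is `InPiBaker` -/

/-- The quadric `p3W ρ = ρ − (1 + X₀)² − 4X₁² − 4X₂` of dimension `3` whose standard cell is the band
`0 < t < g♯(y, y₁)` over `T♯(ρ)` (up to the null face `y = 0`). -/
def p3W (ρ : ℚ) : MvPolynomial (Fin 3) ℚ := C ρ - (1 + X 0) ^ 2 - C 4 * X 1 ^ 2 - C 4 * X 2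

/-- Evaluation of `p3W`. [definition] -/
@[simp] theorem aeval_p3W (z : Fin 3 → ℝ) :
    aeval z (p3W ρ) = (ρ : ℝ) - (1 + z 0) ^ 2 - 4 * z 1 ^ 2 - 4 * z 2 := by
  simp only [p3W, map_sub, map_mul, map_add, map_pow, map_one, MvPolynomial.aeval_X, MvPolynomial.aeval_C,
    eq_ratCast]
  push_cast
  ring

/-- `p3W ρ` is a quadric. [elementary] -/
theorem totalDegree_p3W_le (ρ : ℚ) : (p3W ρ).totalDegree ≤ 2 := by
  unfold p3W
  refine (MvPolynomial.totalDegree_sub _ _).trans (max_le ?_ ?_)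
  · refine (MvPolynomial.totalDegree_sub _ _).trans (max_le ?_ ?_)
    · refine (MvPolynomial.totalDegree_sub _ _).trans (max_le (by simp) ?_)
      have h1 : ((1 : MvPolynomial (Fin 3) ℚ) + X 0).totalDegree ≤ 1 :=
        (MvPolynomial.totalDegree_add _ _).trans (max_le (by simp) (by simp [MvPolynomial.totalDegree_X]))
      exact (MvPolynomial.totalDegree_pow _ _).trans (by omega)
    · refine (MvPolynomial.totalDegree_mul _ _).trans ?_
      rw [MvPolynomial.totalDegree_C, MvPolynomial.totalDegree_X_pow]
  · refine (MvPolynomial.totalDegree_mul _ _).trans ?_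
    rw [MvPolynomial.totalDegree_C, MvPolynomial.totalDegree_X]
    norm_num

/-- The constant-weight band `bandW = [{(y, y₁, t) | (y, y₁) ∈ T♯(ρ), 0 < t < g♯(y, y₁)}, 8q]`. -/
def bandW (ρ q : ℚ) (h4 : ρ ≤ 4) : KZ.IntegralRep 3 :=
  bandRep (tSetH ρ) (isSemialgebraic_tSetH ρ) (tSetH_subset_Icc h4) (fun _ => (0 : ℝ)) (gH ρ)
    (isSemialgebraicFunOn_zero (isSemialgebraic_tSetH ρ)) (isSemialgebraicFunOn_gH (isSemialgebraic_tSetH ρ))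
    (fun _ _ => le_rfl) (fun y _ => gH_le_one h4 y) (8 * q)

/-- Membership in the wide band, in coordinates. [definition] -/
theorem mem_bandW_iff (q : ℚ) (h4 : ρ ≤ 4) {z : Fin 3 → ℝ} :
    z ∈ (bandW ρ q h4).domain ↔
      (0 ≤ z 0 ∧ 0 < z 1 ∧ (1 + z 0) ^ 2 + 4 * z 1 ^ 2 < ρ) ∧
        0 < z 2 ∧ z 2 < ((ρ : ℝ) - (1 + z 0) ^ 2 - 4 * z 1 ^ 2) / 4 :=
  Iff.rfl

/-- **Rule (3): `[bandW] − [tRepH] ∈ relations`.** [KontsevichZagier2001 §1.2 rule (3)] -/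
theorem of_bandW_sub_of_tRepH_mem_relations (q : ℚ) (h4 : ρ ≤ 4) :
    KZ.of (bandW ρ q h4) - KZ.of (tRepH ρ q h4) ∈ KZ.relations :=
  of_bandRep_sub_of_lenRep_mem_relations (tSetH ρ) (isSemialgebraic_tSetH ρ) (tSetH_subset_Icc h4)
    (fun _ => (0 : ℝ)) (gH ρ) (isSemialgebraicFunOn_zero (isSemialgebraic_tSetH ρ))
    (isSemialgebraicFunOn_gH (isSemialgebraic_tSetH ρ)) (fun _ _ => le_rfl) (fun _ hy => (gH_pos hy).le)
    (fun y _ => gH_le_one h4 y) (8 * q)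

/-- The wide band is the standard cell of `p3W ρ` plus the null face `{y = 0}`. [elementary] -/
theorem bandW_domain_eq_union (q : ℚ) (h4 : ρ ≤ 4) :
    (bandW ρ q h4).domain =
      (cellRep (p3W ρ) (8 * q)).domain ∪ ((bandW ρ q h4).domain ∩ {z | z 0 = 0}) := by
  have h4' : (ρ : ℝ) ≤ 4 := by exact_mod_cast h4
  ext z
  rw [mem_union, mem_inter_iff, mem_bandW_iff, cellRep_domain, mem_setOf_eq, mem_setOf_eq, aeval_p3W]
  constructor
  · rintro ⟨⟨h0, h1, hr⟩, ht, htg⟩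
    rcases h0.lt_or_eq with h0' | h0'
    · have hz0 : z 0 < 1 := by nlinarith [sq_nonneg (z 1)]
      have hz1 : z 1 < 1 := by nlinarith
      have hz2 : z 2 < 1 := by nlinarith [sq_nonneg (z 1)]
      refine Or.inl ⟨fun j => ?_, by linarith⟩
      fin_cases j
      · exact ⟨h0', hz0⟩
      · exact ⟨h1, hz1⟩
      · exact ⟨ht, hz2⟩
    · exact Or.inr ⟨⟨⟨h0, h1, hr⟩, ht, htg⟩, h0'.symm⟩
  · rintro (⟨hj, hP⟩ | ⟨hD, -⟩)
    · obtain ⟨h0, -⟩ := hj 0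
      obtain ⟨h1, -⟩ := hj 1
      obtain ⟨ht, -⟩ := hj 2
      exact ⟨⟨h0.le, h1, by linarith⟩, ht, by linarith⟩
    · exact hD

/-- **`bandW` is `InBaker`**: split off the null face `{y = 0}` (rule (1a)); the rest is the standard
cell of the `3`-dimensional quadric `p3W ρ`. [KontsevichZagier2001 §1.2; Baker1975 Thm 2.1] -/
theorem inBaker_bandW (q : ℚ) (h4 : ρ ≤ 4) : InBaker (KZ.of (bandW ρ q h4)) := by
  have hA : IsSemialgebraic ℚ (cellRep (p3W ρ) (8 * q)).domain :=
    (cellRep (p3W ρ) (8 * q)).isSemialgebraic_domain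
  have hB : IsSemialgebraic ℚ ((bandW ρ q h4).domain ∩ {z | z 0 = 0}) :=
    (bandW ρ q h4).isSemialgebraic_domain.inter (isSemialgebraic_hyperplane3 0)
  have hAr : (cellRep (p3W ρ) (8 * q)).domain ⊆ (bandW ρ q h4).domain := by
    rw [bandW_domain_eq_union q h4]; exact subset_union_left
  refine ConicDescent.InBaker.of_split (bandW ρ q h4) hA hB hAr inter_subset_left
    (bandW_domain_eq_union q h4) (measure_mono_null (fun z hz => hz.2.2) (volume_hyperplane3 0)) ?_ ?_
  · exact (inBaker_cellRep_three (p3W ρ) (totalDegree_p3W_le ρ) (8 * q)).congr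
      (KZ.of_sub_of_mem_relations_of_eqOn rfl fun z _ => by
        rw [KZ.IntegralRep.integrand_restrict, cellRep_integrand]; rfl)
  · exact ConicDescent.InBaker.of_mem_relations
      (KZ.of_mem_relations_of_volume_eq_zero _ (measure_mono_null (fun z hz => hz.2) (volume_hyperplane3 0)))

/-- **The planar factor `tRepH ρ q = [T♯(ρ), 8q·g♯]` is `InBaker`** (`ρ ≤ 4`).
[KontsevichZagier2001 §1.2; Baker1975 Thm 2.1] -/
theorem inBaker_tRepH (q : ℚ) (h4 : ρ ≤ 4) : InBaker (KZ.of (tRepH ρ q h4)) :=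
  inBaker_congr' (inBaker_bandW q h4) (of_bandW_sub_of_tRepH_mem_relations q h4)

/-- **The wide chart source `tRepH × (quarter disc)` is `InPiBaker`.** [KontsevichZagier2001 §1.2, §4.1] -/
theorem inPiBaker_srcRepH (q : ℚ) (h4 : ρ ≤ 4) : InPiBaker (KZ.of (srcRepH ρ q h4)) := by
  obtain ⟨y, hy, hrel⟩ := inBaker_tRepH q h4
  have h1 : InPiBaker (KZ.of (tRepH ρ q h4) * KZ.of (hqRep 1)) := PiB.InPiBaker.of_mul_sub_mem hy hrel
  have h2 : InPiBaker (KZ.of (tRepH ρ q h4) * KZ.of (cellRep discPoly 1)) :=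
    h1.congr (by rw [← mul_sub]; exact KZ.of_mul_mem_relations _ of_disc_sub_of_hqRep_mem_relations)
  rwa [KZ.of_mul_of] at h2

/-- **The wide cap `[K_0(ρ), q]` is `InPiBaker`** for every `ρ ≤ 4` (part 111). [KontsevichZagier2001 §1.2] -/
theorem inPiBaker_capRepW_zero (q : ℚ) (h4 : ρ ≤ 4) : InPiBaker (KZ.of (capRepW ρ q h4 0)) :=
  inPiBaker_congr' (inPiBaker_srcRepH q h4) (of_srcRepH_sub_of_capRepW_mem_relations q h4)

/-- **Every cap `[K_i(ρ), q]`, `ρ ≤ 4`, is `InPiBaker`.** [KontsevichZagier2001 §1.2] -/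
theorem inPiBaker_capRepW (q : ℚ) (h4 : ρ ≤ 4) (i : Fin 4) : InPiBaker (KZ.of (capRepW ρ q h4 i)) :=
  inPiBaker_congr' (inPiBaker_capRepW_zero q h4) (of_capRepW_zero_sub_of_capRepW_mem_relations q h4 i)

/-! #### 2. The overlap `[K_{im}(ρ), q]`, `ρ ≤ 3`, is `InPiBaker` -/

/-- The quadric `p3P ρ = ρ − (1 + X₀)² − (1 + X₁)² − X₂` of dimension `3` whose standard cell is the
band `0 < t < g₂(y₀, y₁)` over `T₂(ρ)` (up to the null faces `y₀ = 0`, `y₁ = 0`). -/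
def p3P (ρ : ℚ) : MvPolynomial (Fin 3) ℚ := C ρ - (1 + X 0) ^ 2 - (1 + X 1) ^ 2 - X 2

/-- Evaluation of `p3P`. [definition] -/
@[simp] theorem aeval_p3P (z : Fin 3 → ℝ) :
    aeval z (p3P ρ) = (ρ : ℝ) - (1 + z 0) ^ 2 - (1 + z 1) ^ 2 - z 2 := by
  simp [p3P]

/-- `p3P ρ` is a quadric. [elementary] -/
theorem totalDegree_p3P_le (ρ : ℚ) : (p3P ρ).totalDegree ≤ 2 := by
  unfold p3P
  have h1 : ∀ j : Fin 3, ((1 : MvPolynomial (Fin 3) ℚ) + X j).totalDegree ≤ 1 := fun j =>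
    (MvPolynomial.totalDegree_add _ _).trans (max_le (by simp) (by simp [MvPolynomial.totalDegree_X]))
  refine (MvPolynomial.totalDegree_sub _ _).trans (max_le ?_ ?_)
  · refine (MvPolynomial.totalDegree_sub _ _).trans (max_le ?_ ?_)
    · refine (MvPolynomial.totalDegree_sub _ _).trans (max_le (by simp) ?_)
      exact (MvPolynomial.totalDegree_pow _ _).trans (by have := h1 0; omega)
    · exact (MvPolynomial.totalDegree_pow _ _).trans (by have := h1 1; omega)
  · simp [MvPolynomial.totalDegree_X]

/-- The constant-weight band `bandP = [{(y₀, y₁, t) | (y₀, y₁) ∈ T₂(ρ), 0 < t < g₂(y₀, y₁)}, q]`. -/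
def bandP (ρ q : ℚ) (h3 : ρ ≤ 3) : KZ.IntegralRep 3 :=
  bandRep (t2Set ρ) (isSemialgebraic_t2Set ρ) (t2Set_subset_Icc (le_four_of_le_three h3)) (fun _ => (0 : ℝ))
    (g2 ρ) (isSemialgebraicFunOn_zero (isSemialgebraic_t2Set ρ)) (isSemialgebraicFunOn_g2 (isSemialgebraic_t2Set ρ))
    (fun _ _ => le_rfl) (fun _ hy => g2_le_one h3 hy) q

/-- Membership in the overlap band, in coordinates. [definition] -/
theorem mem_bandP_iff (q : ℚ) (h3 : ρ ≤ 3) {z : Fin 3 → ℝ} :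
    z ∈ (bandP ρ q h3).domain ↔
      (0 ≤ z 0 ∧ 0 ≤ z 1 ∧ (1 + z 0) ^ 2 + (1 + z 1) ^ 2 < ρ) ∧
        0 < z 2 ∧ z 2 < (ρ : ℝ) - (1 + z 0) ^ 2 - (1 + z 1) ^ 2 :=
  Iff.rfl

/-- **Rule (3): `[bandP] − [t2Rep] ∈ relations`.** [KontsevichZagier2001 §1.2 rule (3)] -/
theorem of_bandP_sub_of_t2Rep_mem_relations (q : ℚ) (h3 : ρ ≤ 3) :
    KZ.of (bandP ρ q h3) - KZ.of (t2Rep ρ q h3) ∈ KZ.relations :=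
  of_bandRep_sub_of_lenRep_mem_relations (t2Set ρ) (isSemialgebraic_t2Set ρ)
    (t2Set_subset_Icc (le_four_of_le_three h3)) (fun _ => (0 : ℝ)) (g2 ρ)
    (isSemialgebraicFunOn_zero (isSemialgebraic_t2Set ρ)) (isSemialgebraicFunOn_g2 (isSemialgebraic_t2Set ρ))
    (fun _ _ => le_rfl) (fun _ hy => (g2_pos hy).le) (fun _ hy => g2_le_one h3 hy) q

/-- The overlap band is the standard cell of `p3P ρ` plus the null faces `{y₀ = 0} ∪ {y₁ = 0}`. [elementary] -/
theorem bandP_domain_eq_union (q : ℚ) (h3 : ρ ≤ 3) :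
    (bandP ρ q h3).domain =
      (cellRep (p3P ρ) q).domain ∪ ((bandP ρ q h3).domain ∩ ({z | z 0 = 0} ∪ {z | z 1 = 0})) := by
  have h3' : (ρ : ℝ) ≤ 3 := by exact_mod_cast h3
  ext z
  rw [mem_union, mem_inter_iff, mem_bandP_iff, cellRep_domain, mem_setOf_eq, mem_union, mem_setOf_eq,
    mem_setOf_eq, aeval_p3P]
  constructor
  · rintro ⟨⟨h0, h1, hr⟩, ht, htg⟩
    rcases h0.lt_or_eq with h0' | h0'
    · rcases h1.lt_or_eq with h1' | h1'
      · have hz0 : z 0 < 1 := by nlinarith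
        have hz1 : z 1 < 1 := by nlinarith
        have hz2 : z 2 < 1 := by nlinarith
        refine Or.inl ⟨fun j => ?_, by linarith⟩
        fin_cases j
        · exact ⟨h0', hz0⟩
        · exact ⟨h1', hz1⟩
        · exact ⟨ht, hz2⟩
      · exact Or.inr ⟨⟨⟨h0, h1, hr⟩, ht, htg⟩, Or.inr h1'.symm⟩
    · exact Or.inr ⟨⟨⟨h0, h1, hr⟩, ht, htg⟩, Or.inl h0'.symm⟩
  · rintro (⟨hj, hP⟩ | ⟨hD, -⟩)
    · obtain ⟨h0, -⟩ := hj 0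
      obtain ⟨h1, -⟩ := hj 1
      obtain ⟨ht, -⟩ := hj 2
      exact ⟨⟨h0.le, h1.le, by linarith⟩, ht, by linarith⟩
    · exact hD

/-- **`bandP` is `InBaker`**: split off the null faces; the rest is the standard cell of the
`3`-dimensional quadric `p3P ρ`. [KontsevichZagier2001 §1.2; Baker1975 Thm 2.1] -/
theorem inBaker_bandP (q : ℚ) (h3 : ρ ≤ 3) : InBaker (KZ.of (bandP ρ q h3)) := by
  have hA : IsSemialgebraic ℚ (cellRep (p3P ρ) q).domain := (cellRep (p3P ρ) q).isSemialgebraic_domain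
  have hH : IsSemialgebraic ℚ ({z : Fin 3 → ℝ | z 0 = 0} ∪ {z | z 1 = 0}) :=
    (isSemialgebraic_hyperplane3 0).union (isSemialgebraic_hyperplane3 1)
  have hB : IsSemialgebraic ℚ ((bandP ρ q h3).domain ∩ ({z | z 0 = 0} ∪ {z | z 1 = 0})) :=
    (bandP ρ q h3).isSemialgebraic_domain.inter hH
  have hvolH : volume ({z : Fin 3 → ℝ | z 0 = 0} ∪ {z | z 1 = 0}) = 0 :=
    measure_union_null (volume_hyperplane3 0) (volume_hyperplane3 1)
  have hAr : (cellRep (p3P ρ) q).domain ⊆ (bandP ρ q h3).domain := by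
    rw [bandP_domain_eq_union q h3]; exact subset_union_left
  refine ConicDescent.InBaker.of_split (bandP ρ q h3) hA hB hAr inter_subset_left
    (bandP_domain_eq_union q h3) (measure_mono_null (fun z hz => hz.2.2) hvolH) ?_ ?_
  · exact (inBaker_cellRep_three (p3P ρ) (totalDegree_p3P_le ρ) q).congr
      (KZ.of_sub_of_mem_relations_of_eqOn rfl fun z _ => by
        rw [KZ.IntegralRep.integrand_restrict, cellRep_integrand]; rfl)
  · exact ConicDescent.InBaker.of_mem_relations
      (KZ.of_mem_relations_of_volume_eq_zero _ (measure_mono_null (fun z hz => hz.2) hvolH))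

/-- **The planar factor `t2Rep ρ q = [T₂(ρ), q·g₂]` is `InBaker`** (`ρ ≤ 3`).
[KontsevichZagier2001 §1.2; Baker1975 Thm 2.1] -/
theorem inBaker_t2Rep (q : ℚ) (h3 : ρ ≤ 3) : InBaker (KZ.of (t2Rep ρ q h3)) :=
  inBaker_congr' (inBaker_bandP q h3) (of_bandP_sub_of_t2Rep_mem_relations q h3)

/-- **The overlap chart source `t2Rep × (quarter disc)` is `InPiBaker`.** [KontsevichZagier2001 §1.2, §4.1] -/
theorem inPiBaker_src2Rep (q : ℚ) (h3 : ρ ≤ 3) : InPiBaker (KZ.of (src2Rep ρ q h3)) := by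
  obtain ⟨y, hy, hrel⟩ := inBaker_t2Rep q h3
  have h1 : InPiBaker (KZ.of (t2Rep ρ q h3) * KZ.of (hqRep 1)) := PiB.InPiBaker.of_mul_sub_mem hy hrel
  have h2 : InPiBaker (KZ.of (t2Rep ρ q h3) * KZ.of (cellRep discPoly 1)) :=
    h1.congr (by rw [← mul_sub]; exact KZ.of_mul_mem_relations _ of_disc_sub_of_hqRep_mem_relations)
  rwa [KZ.of_mul_of] at h2

/-- **The overlap `[K_{01}(ρ), q]` is `InPiBaker`** (`ρ ≤ 3`, part 109). [KontsevichZagier2001 §1.2] -/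
theorem inPiBaker_pairRep_zero_one (q : ℚ) (h3 : ρ ≤ 3) :
    InPiBaker (KZ.of (pairRep ρ q (le_four_of_le_three h3) 0 1)) :=
  inPiBaker_congr' (inPiBaker_src2Rep q h3) (of_src2Rep_sub_of_pairRep_mem_relations q h3)

/-- **Every overlap `[K_{im}(ρ), q]`, `i ≠ m`, `ρ ≤ 3`, is `InPiBaker`.** [KontsevichZagier2001 §1.2] -/
theorem inPiBaker_pairRep (q : ℚ) (h3 : ρ ≤ 3) {i m : Fin 4} (him : i ≠ m) :
    InPiBaker (KZ.of (pairRep ρ q (le_four_of_le_three h3) i m)) :=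
  inPiBaker_congr' (inPiBaker_pairRep_zero_one q h3)
    (of_pairRep_zero_one_sub_of_pairRep_mem_relations' q (le_four_of_le_three h3) him)

/-! #### 3. The signed peel -/

/-- The orthant ball `[B_0(ρ), q] ≡ [unit ball cell, ρ²q]` is `InPiBaker` (`0 < ρ ≤ 4`).
[KontsevichZagier2001 §1.2, §4.1] -/
theorem inPiBaker_bRepW_zero (hρ : 0 < ρ) (h4 : ρ ≤ 4) (q : ℚ) : InPiBaker (KZ.of (bRepW ρ q h4 0)) :=
  inPiBaker_congr' (PiB.InPiBaker.of_ball4_cell (ρ ^ 2 * q))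
    (of_ball4_cell_sub_of_bRepW_zero_mem_relations hρ h4 q)

/-- **The partially peeled caps `[L_{i,m}(ρ), q]`, `m ≤ i`, are `InPiBaker`** (`ρ ≤ 3`; induction on
`m`: `L_{i,0} = K_i`, `[L_{i,m+1}] = [L_{i,m}] − [K_{im}]`). [KontsevichZagier2001 §1.2 rule (1)] -/
theorem inPiBaker_lRep (q : ℚ) (h3 : ρ ≤ 3) (i : Fin 4) :
    ∀ m : ℕ, m ≤ (i : ℕ) → InPiBaker (KZ.of (lRep ρ q (le_four_of_le_three h3) i m))
  | 0, _ => (inPiBaker_capRepW q (le_four_of_le_three h3) i).congr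
      (of_lRep_zero_sub_of_capRepW_mem_relations q (le_four_of_le_three h3) i)
  | m + 1, hm => by
    have hmi : m < (i : ℕ) := hm
    have him : i ≠ ⟨m, by omega⟩ := fun h => by
      have := congrArg Fin.val h; simp at this; omega
    have hrel := of_lRep_sub_sub_mem_relations q h3 (i := i) (m := ⟨m, by omega⟩) hmi
    exact inPiBaker_congr' ((inPiBaker_lRep q h3 i m hmi.le).sub (inPiBaker_pairRep q h3 him))
      (by rw [sub_right_comm]; exact hrel)

/-- One peeling step: `[B_{i+1}] ≡ [B_i] − [L_{i,i}]` (`ρ ≤ 3`). [KontsevichZagier2001 §1.2 rule (1)] -/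
theorem inPiBaker_bRepW_succ (q : ℚ) (h3 : ρ ≤ 3) (i : Fin 4)
    (hB : InPiBaker (KZ.of (bRepW ρ q (le_four_of_le_three h3) i))) :
    InPiBaker (KZ.of (bRepW ρ q (le_four_of_le_three h3) ((i : ℕ) + 1))) :=
  inPiBaker_congr' (hB.sub (inPiBaker_lRep q h3 i i le_rfl))
    (by rw [sub_right_comm]; exact of_bRepW_sub_sub_mem_relations q (le_four_of_le_three h3) i)

/-- `[B_4(ρ), q]` is `InPiBaker` (`0 < ρ ≤ 3`). [KontsevichZagier2001 §1.2] -/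
theorem inPiBaker_bRepW_four (hρ : 0 < ρ) (h3 : ρ ≤ 3) (q : ℚ) :
    InPiBaker (KZ.of (bRepW ρ q (le_four_of_le_three h3) 4)) :=
  inPiBaker_bRepW_succ q h3 3 (inPiBaker_bRepW_succ q h3 2 (inPiBaker_bRepW_succ q h3 1
    (inPiBaker_bRepW_succ q h3 0 (inPiBaker_bRepW_zero hρ (le_four_of_le_three h3) q))))

/-! #### 4. THE SPECIMEN, `ρ ≤ 3` -/

/-- **THE SPECIMEN (gen 13, addendum 1): the face-cut ball cell `[(0,1)⁴ ∩ {Σxᵢ² < ρ}, q]` is `InPiBaker`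
for every rational `ρ ≤ 3`.** [KontsevichZagier2001 §1.2, §4.1; Baker1975 Thm 2.1] -/
theorem inPiBaker_cutBall_three (h3 : ρ ≤ 3) (q : ℚ) : InPiBaker (KZ.of (cellRep (cutPoly ρ) q)) := by
  by_cases h2 : ρ ≤ 2
  · exact inPiBaker_cutBall h2 q
  · have hρ : 0 < ρ := by linarith [not_le.1 h2]
    exact inPiBaker_congr' (inPiBaker_bRepW_four hρ h3 q)
      (of_bRepW_four_sub_of_cellRep_mem_relations q (le_four_of_le_three h3))

/-- **`cutPoly ρ` (`ρ ≤ 3`) is in the `[hq]·B`-class.** [KontsevichZagier2001 §1.2, §4.1] -/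
theorem piBDescentAt_cutBall_three (h3 : ρ ≤ 3) : QuadricDescentAt piBGens (cutPoly ρ) :=
  piBDescentAt_of_inPiBaker (inPiBaker_cutBall_three h3)

/-- Permuted reflections of face-cut balls `ρ ≤ 3` are in the `[hq]·B`-class. [KontsevichZagier2001 §1.2 rule (2)] -/
theorem piBDescentAt_cutBall_three_rename_reflect (h3 : ρ ≤ 3) (σ : Equiv.Perm (Fin 4)) (j : Fin 4) :
    QuadricDescentAt piBGens (rename σ (bind₁ (KZ.reflectSubst j) (cutPoly ρ))) :=
  descentAt_rename_reflect σ j (totalDegree_cutPoly_le ρ) (piBDescentAt_cutBall_three h3)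

/-- Face-cut balls `ρ ≤ 3` are in the `A`-class. [this node] -/
theorem affDescentAt_cutBall_three (h3 : ρ ≤ 3) : QuadricDescentAt affGens (cutPoly ρ) :=
  affDescentAt_of_piBDescentAt (piBDescentAt_cutBall_three h3)

/-- **Conjecture 1 (kernel form) for families of face-cut balls with `ρᵢ ≤ 3`, UNCONDITIONALLY**: every
vanishing `ℤ`-combination of constant-weight cells `[C_{ρᵢ}, qᵢ]` is a Kontsevich–Zagier relation.
[KontsevichZagier2001 §1.2, §4.1; Baker1975 Thm 2.1; this node] -/
theorem sum_mem_relations_cutBalls_three (k : ℕ) (ρ : Fin k → ℚ) (h3 : ∀ i, ρ i ≤ 3) (q : Fin k → ℚ)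
    (r : Fin k → KZ.IntegralRep 4) (c : Fin k → ℤ)
    (hr : ∀ i, (r i).domain = {x | (∀ j, 0 < x j ∧ x j < 1) ∧ 0 < MvPolynomial.aeval x (cutPoly (ρ i))} ∧
      ∀ x ∈ (r i).domain, (r i).integrand x = (q i : ℝ))
    (hv : KZ.eval (∑ i, c i • KZ.of (r i)) = 0) : (∑ i, c i • KZ.of (r i)) ∈ KZ.relations :=
  sum_mem_relations_piB k (fun _ => 4) (fun i => cutPoly (ρ i)) q r c
    (fun i => piBDescentAt_cutBall_three (h3 i)) hr (fun i => totalDegree_cutPoly_le (ρ i)) hv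

end Summit.KontsevichZagierPeriods.RootDecompWalshStrata.CutBall4

end
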